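import Literature.AnabelianGeometry.Anabelioids.FreeObjects
import Literature.AnabelianGeometry.Anabelioids.ExactFunctorProofs
import Literature.AnabelianGeometry.SemiGraphs.Commensurability
import HarnessLib

/-!
# The glued finite étale covering of a graph of anabelioids of bounded order
# ([SemiAnbd] proof of Proposition 2.5, p. 27) — proof companion

Mochizuki, *Semi-graphs of anabelioids*, Publ. RIMS **42** (2006), proof of Proposition 2.5,
author's manuscript p. 27 [cite: MochizukiSemiAnbd2006, Prop. 2.5 p.27]: "it suffices to construct,
under the further assumption that `𝒢` is of bounded order, a finite étale covering of `𝒢` each of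
whose constituent anabelioids is trivial. We construct such a covering by gluing: Let `M ≥ 1` be an
integer such all of the orders `[π̂₁(𝒢_v) : 1]` divide `M`. Over the vertex `v`, we take the covering
to be the union of `M/[π̂₁(𝒢_v) : 1]` copies of some “universal covering” of `𝒢_v` […]. If `e` is an
edge that abuts to the vertex `v`, then the restriction of this covering to `e` is a union of
`M/[π̂₁(𝒢_e) : 1]` copies of some universal covering of `𝒢_e` — i.e., a covering of `𝒢_e` whose
isomorphism class is independent of `v`! Thus, by choosing appropriate gluing isomorphisms, we
obtain a covering of `𝒢` having the desired properties."

This proof-only file (no definitions) carries out exactly this GLUING over abc-iut-L3-t1's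
descent-data category `B(𝒢)` (`SemiGraphOfAnabelioids.BObj`, `GraphOfAnabelioids.lean`), on top of
abc-iut-L3-d6's `Anabelioids/FreeObjects.lean` (free objects of prescribed fibre cardinality in a
Galois category with finite `π₁`, their isomorphy, and transfer of freeness along basepoints and
`π₁`-monomorphisms):

* `SemiGraphOfAnabelioids.exists_boundedOrderCovering` — for `𝒢` of injective type all of whose
  vertex groups are finite of order dividing `M ≥ 1` (the witness of `IsOfBoundedOrder`), there is an
  object `A ∈ B(𝒢)` such that for EVERY vertex `v` and EVERY basepoint `F` of `𝒢_v` the fibre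
  `F(A_v)` is a free `Π_v`-set of cardinality `M`, and likewise `F(A_e)` for every edge `e` possessing
  a branch that abuts to a vertex and every basepoint `F` of `𝒢_e` (over a vertex-less edge the
  constituent is unconstrained and chosen arbitrarily).

Consumers: abc-iut-L6-t18's discharge of `proposition_2_5_ii` (`NonCommensurabilityProofs.lean`: the
Galois closure of this covering gives the normal open subgroup of [SemiAnbd] Prop. 2.5 (ii)) and
abc-iut-L3-d6's discharge of `proposition_2_5_i` (G21). Seat abc-iut-L6-t18 (ROW G26; shared-lemma
ruling abc-iut-L3-lead 2026-08-25T20:53:03Z). Nothing here concerns [IUTchIII] Cor. 3.12.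
-/

namespace Literature.AnabelianGeometry.SemiGraphs

open CategoryTheory CategoryTheory.Limits CategoryTheory.PreGaloisCategory
open Literature.AnabelianGeometry.Anabelioids

universe v₁ u₁ u

namespace SemiGraphOfAnabelioids

/-- **The glued covering of a graph of anabelioids of bounded order** ([SemiAnbd] proof of
Proposition 2.5, p. 27): let `𝒢` be of injective type and `M ≥ 1` an integer divisible by the
(finite) orders of all vertex groups `Π_v` (the witness of `IsOfBoundedOrder`).  Then there is an
object `A = {A_v, A_e, ψ_b}` of `B(𝒢)` — over `v`, "`M/[Π_v : 1]` copies of the universal covering of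
`𝒢_v`", glued along "appropriate gluing isomorphisms" — such that for every vertex `v` and every
basepoint `F` of `𝒢_v` the fibre `F(A_v)` is a free `Π_v`-set of cardinality `M`, and for every branch
`b` abutting to a vertex and every basepoint `F` of `𝒢_e`, `e ∋ b`, the fibre `F(A_e)` is a free
`Π_e`-set of cardinality `M`. [cite: MochizukiSemiAnbd2006, Prop. 2.5 p.27] -/
theorem exists_boundedOrderCovering (𝒢 : SemiGraphOfAnabelioids.{v₁, u₁, u})
    (hinj : 𝒢.IsOfInjectiveType) {M : ℕ} (hM : 1 ≤ M)
    (hbd : ∀ (v : 𝒢.graph.Vertex) (F : 𝒢.V v ⥤ FintypeCat.{v₁}) [FiberFunctor F],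
      Finite (Aut F) ∧ Nat.card (Aut F) ∣ M) :
    ∃ A : 𝒢.BObj,
      (∀ (v : 𝒢.graph.Vertex) (F : 𝒢.V v ⥤ FintypeCat.{v₁}) [FiberFunctor F],
        (∀ (σ : Aut F) (x : F.obj (A.S v)), σ • x = x → σ = 1) ∧ Nat.card (F.obj (A.S v)) = M) ∧
      (∀ (b : 𝒢.graph.Branch) (v : 𝒢.graph.Vertex), 𝒢.graph.abuts b = some v →
        ∀ (F : 𝒢.E (𝒢.graph.edgeOf b) ⥤ FintypeCat.{v₁}) [FiberFunctor F],
        (∀ (σ : Aut F) (x : F.obj (A.T (𝒢.graph.edgeOf b))), σ • x = x → σ = 1) ∧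
          Nat.card (F.obj (A.T (𝒢.graph.edgeOf b))) = M) := by
  classical
  have hM0 : 0 < M := hM
  -- chosen basepoints
  let FV : ∀ v : 𝒢.graph.Vertex, 𝒢.V v ⥤ FintypeCat.{v₁} :=
    fun v => GaloisCategory.getFiberFunctor (𝒢.V v)
  let FE : ∀ e : 𝒢.graph.Edge, 𝒢.E e ⥤ FintypeCat.{v₁} :=
    fun e => GaloisCategory.getFiberFunctor (𝒢.E e)
  -- the vertex constituents: `M/[Π_v:1]` copies of the universal covering
  have hS : ∀ v : 𝒢.graph.Vertex, ∃ S : 𝒢.V v,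
      (∀ (σ : Aut (FV v)) (x : (FV v).obj S), σ • x = x → σ = 1) ∧ Nat.card ((FV v).obj S) = M := by
    intro v
    haveI := (hbd v (FV v)).1
    obtain ⟨k, hk⟩ := (hbd v (FV v)).2
    obtain ⟨S, hS, hc⟩ := exists_free_card_eq (FV v) k
    exact ⟨S, hS, by rw [hc, hk, mul_comm]⟩
  choose S hSfree hScard using hS
  -- … whose fibres are free of cardinality `M` at EVERY basepoint
  have hSall : ∀ (v : 𝒢.graph.Vertex) (F : 𝒢.V v ⥤ FintypeCat.{v₁}) [FiberFunctor F],
      (∀ (σ : Aut F) (x : F.obj (S v)), σ • x = x → σ = 1) ∧ Nat.card (F.obj (S v)) = M := by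
    intro v F _
    obtain ⟨e⟩ := nonempty_iso_of_fiberFunctor F (FV v)
    exact ⟨free_of_iso_fiberFunctor e.symm (hSfree v),
      (card_fiber_eq_of_iso_fiberFunctor e (S v)).trans (hScard v)⟩
  -- the pulled-back vertex constituents over a branch: free of cardinality `M` at every basepoint
  have hPull : ∀ (b : 𝒢.graph.Branch) (v : 𝒢.graph.Vertex) (h : 𝒢.graph.abuts b = some v)
      (F : 𝒢.E (𝒢.graph.edgeOf b) ⥤ FintypeCat.{v₁}) [FiberFunctor F],
      (∀ (σ : Aut F) (x : F.obj ((𝒢.pull b v h).pullback.obj (S v))), σ • x = x → σ = 1) ∧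
        Nat.card (F.obj ((𝒢.pull b v h).pullback.obj (S v))) = M := by
    intro b v h F _
    haveI : FiberFunctor ((𝒢.pull b v h).pullback ⋙ F) :=
      fiberFunctor_comp_of_exact (𝒢.pull b v h).pullback F
    obtain ⟨h1, h2⟩ := hSall v ((𝒢.pull b v h).pullback ⋙ F)
    exact ⟨free_comp_of_injective (𝒢.pull b v h).pullback F (hinj.isPi1Mono b v h F) h1, h2⟩
  -- finiteness of the edge groups of edges with an abutting branch
  have hEfin : ∀ (b : 𝒢.graph.Branch) (v : 𝒢.graph.Vertex) (h : 𝒢.graph.abuts b = some v)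
      (F : 𝒢.E (𝒢.graph.edgeOf b) ⥤ FintypeCat.{v₁}) [FiberFunctor F],
      Finite (Aut F) ∧ Nat.card (Aut F) ∣ M := by
    intro b v h F _
    haveI : FiberFunctor ((𝒢.pull b v h).pullback ⋙ F) :=
      fiberFunctor_comp_of_exact (𝒢.pull b v h).pullback F
    obtain ⟨hfin, hdvd⟩ := hbd v ((𝒢.pull b v h).pullback ⋙ F)
    haveI := hfin
    have hι := hinj.isPi1Mono b v h F
    exact ⟨Finite.of_injective _ hι, (Subgroup.card_dvd_of_injective _ hι).trans hdvd⟩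
  -- the edge constituents (arbitrary over vertex-less edges)
  have hT : ∀ e : 𝒢.graph.Edge, ∃ T : 𝒢.E e, (Finite (Aut (FE e)) ∧ Nat.card (Aut (FE e)) ∣ M) →
      (∀ (σ : Aut (FE e)) (x : (FE e).obj T), σ • x = x → σ = 1) ∧ Nat.card ((FE e).obj T) = M := by
    intro e
    by_cases hfin : Finite (Aut (FE e)) ∧ Nat.card (Aut (FE e)) ∣ M
    · haveI := hfin.1
      obtain ⟨k, hk⟩ := hfin.2
      obtain ⟨T, hT, hc⟩ := exists_free_card_eq (FE e) k
      exact ⟨T, fun _ => ⟨hT, by rw [hc, hk, mul_comm]⟩⟩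
    · exact ⟨⊤_ (𝒢.E e), fun h' => absurd h' hfin⟩
  choose T hT using hT
  have hTall : ∀ (b : 𝒢.graph.Branch) (v : 𝒢.graph.Vertex), 𝒢.graph.abuts b = some v →
      ∀ (F : 𝒢.E (𝒢.graph.edgeOf b) ⥤ FintypeCat.{v₁}) [FiberFunctor F],
      (∀ (σ : Aut F) (x : F.obj (T (𝒢.graph.edgeOf b))), σ • x = x → σ = 1) ∧
        Nat.card (F.obj (T (𝒢.graph.edgeOf b))) = M := by
    intro b v h F _
    obtain ⟨h1, h2⟩ := hT (𝒢.graph.edgeOf b) (hEfin b v h (FE (𝒢.graph.edgeOf b)))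
    obtain ⟨e⟩ := nonempty_iso_of_fiberFunctor F (FE (𝒢.graph.edgeOf b))
    exact ⟨free_of_iso_fiberFunctor e.symm h1,
      (card_fiber_eq_of_iso_fiberFunctor e (T (𝒢.graph.edgeOf b))).trans h2⟩
  -- the gluing isomorphisms `ψ_b : b^* A_v ≅ A_e`
  have hψ : ∀ (b : 𝒢.graph.Branch) (v : 𝒢.graph.Vertex) (h : 𝒢.graph.abuts b = some v),
      Nonempty ((𝒢.pull b v h).pullback.obj (S v) ≅ T (𝒢.graph.edgeOf b)) := by
    intro b v h
    haveI := (hEfin b v h (FE (𝒢.graph.edgeOf b))).1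
    obtain ⟨h1, h2⟩ := hPull b v h (FE (𝒢.graph.edgeOf b))
    obtain ⟨h3, h4⟩ := hTall b v h (FE (𝒢.graph.edgeOf b))
    exact nonempty_iso_of_free (FE (𝒢.graph.edgeOf b)) h1 h3 (h2.trans h4.symm)
  exact ⟨⟨S, T, fun b v h => (hψ b v h).some⟩, hSall, hTall⟩

end SemiGraphOfAnabelioids

end Literature.AnabelianGeometry.SemiGraphs
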